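import Summits.CriticalPhenomena.PercolationContinuityZ3.Theorems.PercNearOneGluingNoHeavyLowerTailIncStarBranchLemma
import HarnessLib

/-!
# The R-side lemma of THEOREM C½ (STAR½ on apex-forests), I: the port and coincident cases

Support file for the Sahi programme (`--supports stmt-CriticalPhenomena-4575`, prover prim-sahi-p2 gen 19).  No definitions, no named
facts, no sorries; standard axioms.  Memo `FROM-prim-nh-lead-4575-g120-STAR-HALF.md` §5 (ii)–(iii) (lead g120, THEOREM B½-forest / C½) and
`prim-sahi-p2/PROOF-E3.md` (29f)–(29h).

Along a 1|2 environment bridge the STAR½ functional `F = E₃ − ½(m_abc − m_am_bm_c)` has `F″ = −2σ(α·RS + d_bd_c·Λ₀)` with `Λ₀ ≥ 0`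
(`IncStar.bridgeConcavityHalf_bracket`, lead p371027) and the R-SIDE quantity of the far side at the far endpoint `v` with targets `b, c` — in
root-connection form (`P = prodBernoulli w`, root `s`; Theorem B's `σ′ = P(s↔v)`, `d_t = D_t = P(t↔v ∧ v↛s)`, `d_bc = D_bc`, `ξ_b = Ξ_b =
P(b↔v ∧ v↛s ∧ s↔c)`, `y_t = P(s↔v ∧ s↔t)`, `m_t = P(s↔t)`):
  **`RS(w; v; b, c) = σ′(Ξ_b + Ξ_c + D_bc) + D_b·y_c + D_c·y_b − (3/2)σ′(m_bD_c + m_cD_b) − 3σ′D_bD_c`.**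
R-SIDE LEMMA (lead): `RS ≥ 0` when the far side is a forest and rule (R) holds (`v ∈ {b,c}`, or `b = c`, or `b, c` in different branches at
`v`); exact brute force (gen19 `rs_check.py`): 0/500 under (R).  This file: the two one-block cases, from Harris and the branch lemma:
* `rs_port` (`b = v`): `RS = ½σ′H_c + ((3/2)σ′ − 1)·Cov_c` with `Cov_c = D_c + H_c − (1−σ′)Z_c ≤ 0` (Harris) and `H_c + Cov_c ≥ 0`
  (`IncStar.branchLemma`): nonnegative in both regimes `σ′ ≤ 2/3`, `σ′ > 2/3`;
* `rs_coincident` (`b = c`): `RS = D_b·[σ′(1 − Z_b) − 2Cov_b] ≥ 0` (Harris only).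
The two-branch case is `…IncStarRSideDiffBranch`.
-/

noncomputable section

namespace Summit.CriticalPhenomena.PercolationContinuityZ3.Theorems

namespace IncStar

open MeasureTheory Set Literature.Probability.Percolation Literature.Probability.LatticeModels EdgeInduction
open scoped Classical

variable {n : ℕ}

/-- Arithmetic of the port case. [this work] -/
theorem rs_port_real (σ A Dc Hc mc Zc : ℝ) (hA : A = 1 - σ) (hZ : Zc = mc + Dc) (hσ0 : 0 ≤ σ) (hσ1 : σ ≤ 1) (hH : 0 ≤ Hc)
    (Br : A * Zc ≤ Dc + 2 * Hc) (Har : Dc + Hc ≤ A * Zc) :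
    0 ≤ σ * (Hc + 0 + Dc) + A * (mc - Hc) + Dc * σ - 3 / 2 * σ * (σ * Dc + mc * A) - 3 * σ * A * Dc := by
  have key : σ * (Hc + 0 + Dc) + A * (mc - Hc) + Dc * σ - 3 / 2 * σ * (σ * Dc + mc * A) - 3 * σ * A * Dc
      = 1 / 2 * σ * Hc + (3 / 2 * σ - 1) * (Dc + Hc - A * Zc) := by rw [hA, hZ]; ring
  rw [key]
  by_cases h : 3 / 2 * σ - 1 ≤ 0
  · have h1 : 0 ≤ (3 / 2 * σ - 1) * (Dc + Hc - A * Zc) := mul_nonneg_of_nonpos_of_nonpos h (by linarith)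
    have h2 : 0 ≤ 1 / 2 * σ * Hc := by nlinarith
    linarith
  · push Not at h
    nlinarith [mul_nonneg h.le (by linarith : 0 ≤ Dc + 2 * Hc - A * Zc)]

/-- **R-side lemma, port case** (`b = v`). [this work] -/
theorem rs_port (w : Sym2 (Fin n) → unitInterval) {s v : Fin n} (c : Fin n) (hv : v ≠ s)
    (hforest : (SimpleGraph.fromEdgeSet {z : Sym2 (Fin n) | s ∉ z ∧ w z ≠ 0}).IsAcyclic) :
    0 ≤ (prodBernoulli w).real (openConn s v) * ((prodBernoulli w).real ((openConn v v \ openConn s v) ∩ openConn s c)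
            + (prodBernoulli w).real ((openConn c v \ openConn s v) ∩ openConn s v) + (prodBernoulli w).real ((openConn v v ∩ openConn c v) \ openConn s v))
        + (prodBernoulli w).real (openConn v v \ openConn s v) * (prodBernoulli w).real (openConn s v ∩ openConn s c) + (prodBernoulli w).real (openConn c v \ openConn s v) * (prodBernoulli w).real (openConn s v ∩ openConn s v)
        - 3 / 2 * (prodBernoulli w).real (openConn s v) * ((prodBernoulli w).real (openConn s v) * (prodBernoulli w).real (openConn c v \ openConn s v)
            + (prodBernoulli w).real (openConn s c) * (prodBernoulli w).real (openConn v v \ openConn s v))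
        - 3 * (prodBernoulli w).real (openConn s v) * (prodBernoulli w).real (openConn v v \ openConn s v) * (prodBernoulli w).real (openConn c v \ openConn s v) := by
  have hm : ∀ X : Set (BondConfig (Fin n)), MeasurableSet X := fun _ => MeasurableSet.of_discrete
  have Br := branchLemma w c hv hforest
  have hvv : (openConn v v : Set (BondConfig (Fin n))) = Set.univ := Set.eq_univ_of_forall fun _ => SimpleGraph.Reachable.refl v
  have e1 : (Set.univ \ openConn s v : Set (BondConfig (Fin n))) = (openConn s v)ᶜ := (Set.compl_eq_univ_sdiff _).symm
  have e2 : ((openConn s v)ᶜ ∩ openConn s c : Set (BondConfig (Fin n))) = (openConn s v)ᶜ ∩ (openConn c v)ᶜ ∩ openConn s c := by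
    ext ω
    simp only [Set.mem_inter_iff, Set.mem_compl_iff]
    constructor
    · rintro ⟨hsv, hsc⟩
      exact ⟨⟨hsv, fun hcv => hsv (SimpleGraph.Reachable.trans hsc hcv)⟩, hsc⟩
    · rintro ⟨⟨hsv, -⟩, hsc⟩
      exact ⟨hsv, hsc⟩
  have e3 : ((openConn c v \ openConn s v) ∩ openConn s v : Set (BondConfig (Fin n))) = ∅ := by
    ext ω; simp only [Set.mem_inter_iff, Set.mem_sdiff, Set.mem_empty_iff_false, iff_false]; tauto
  -- `A = 1 − σ′`, `y_c = m_c − H_c`, `Z_c = m_c + D_c`, Harris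
  have hA : (prodBernoulli w).real (openConn s v)ᶜ = 1 - (prodBernoulli w).real (openConn s v) := probReal_compl_eq_one_sub (hm _)
  have hy : (prodBernoulli w).real (openConn s v ∩ openConn s c)
      = (prodBernoulli w).real (openConn s c) - (prodBernoulli w).real ((openConn s v)ᶜ ∩ (openConn c v)ᶜ ∩ openConn s c) := by
    have hsplit : (prodBernoulli w).real (openConn s c ∩ openConn s v) + (prodBernoulli w).real (openConn s c \ openConn s v)
        = (prodBernoulli w).real (openConn s c) := measureReal_inter_add_sdiff (hm _)
    have e2' : (openConn s c \ openConn s v : Set (BondConfig (Fin n))) = (openConn s v)ᶜ ∩ (openConn c v)ᶜ ∩ openConn s c := by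
      rw [← e2]; ext ω; simp only [Set.mem_sdiff, Set.mem_inter_iff, Set.mem_compl_iff]; tauto
    rw [Set.inter_comm, ← e2']
    linarith
  have hZ : (prodBernoulli w).real (openConn c v ∪ openConn s c)
      = (prodBernoulli w).real (openConn s c) + (prodBernoulli w).real (openConn c v \ openConn s v) := by
    rw [Set.union_comm, ← measureReal_union ?_ (hm _)]
    · congr 1
      ext ω
      simp only [Set.mem_union, Set.mem_sdiff]
      constructor
      · rintro (h | h)
        · exact Or.inl h
        · by_cases hsv : ω ∈ openConn s v
          · exact Or.inl (SimpleGraph.Reachable.trans hsv h.symm)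
          · exact Or.inr ⟨h, hsv⟩
      · rintro (h | ⟨h, -⟩)
        · exact Or.inl h
        · exact Or.inr h
    · exact Set.disjoint_left.2 fun ω hsc h => h.2 (SimpleGraph.Reachable.trans hsc h.1)
  have Har : (prodBernoulli w).real (openConn c v \ openConn s v) + (prodBernoulli w).real ((openConn s v)ᶜ ∩ (openConn c v)ᶜ ∩ openConn s c)
      ≤ (prodBernoulli w).real (openConn s v)ᶜ * (prodBernoulli w).real (openConn c v ∪ openConn s c) := by
    have h := prodBernoulli_harris_upper_lower w ((isUpperSet_openConn c v).union (isUpperSet_openConn s c))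
      (isUpperSet_openConn s v).compl (hm _) (hm _)
    rw [mul_comm]
    refine le_trans (le_of_eq ?_) h
    rw [← measureReal_union ?_ (hm _)]
    · congr 1
      ext ω
      simp only [Set.mem_union, Set.mem_sdiff, Set.mem_inter_iff, Set.mem_compl_iff]
      tauto
    · exact Set.disjoint_left.2 fun ω h1 h2 => h2.1.2 h1.1
  rw [hvv, e1, Set.univ_inter, e2, e3, Set.inter_self, measureReal_empty, hy]
  have hfin := rs_port_real _ _ _ _ ((prodBernoulli w).real (openConn s c)) _ hA hZ measureReal_nonneg measureReal_le_one
    (measureReal_nonneg : 0 ≤ (prodBernoulli w).real ((openConn s v)ᶜ ∩ (openConn c v)ᶜ ∩ openConn s c)) Br Har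
  linarith [hfin]

/-- **R-side lemma, coincident targets** (`b = c`): Harris only. [this work] -/
theorem rs_coincident (w : Sym2 (Fin n) → unitInterval) (s v b : Fin n) :
    0 ≤ (prodBernoulli w).real (openConn s v) * ((prodBernoulli w).real ((openConn b v \ openConn s v) ∩ openConn s b)
            + (prodBernoulli w).real ((openConn b v \ openConn s v) ∩ openConn s b) + (prodBernoulli w).real ((openConn b v ∩ openConn b v) \ openConn s v))
        + (prodBernoulli w).real (openConn b v \ openConn s v) * (prodBernoulli w).real (openConn s v ∩ openConn s b) + (prodBernoulli w).real (openConn b v \ openConn s v) * (prodBernoulli w).real (openConn s v ∩ openConn s b)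
        - 3 / 2 * (prodBernoulli w).real (openConn s v) * ((prodBernoulli w).real (openConn s b) * (prodBernoulli w).real (openConn b v \ openConn s v)
            + (prodBernoulli w).real (openConn s b) * (prodBernoulli w).real (openConn b v \ openConn s v))
        - 3 * (prodBernoulli w).real (openConn s v) * (prodBernoulli w).real (openConn b v \ openConn s v) * (prodBernoulli w).real (openConn b v \ openConn s v) := by
  have hm : ∀ X : Set (BondConfig (Fin n)), MeasurableSet X := fun _ => MeasurableSet.of_discrete
  have e1 : ((openConn b v \ openConn s v) ∩ openConn s b : Set (BondConfig (Fin n))) = ∅ := by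
    ext ω
    simp only [Set.mem_inter_iff, Set.mem_sdiff, Set.mem_empty_iff_false, iff_false, not_and]
    intro h hsb
    exact h.2 (SimpleGraph.Reachable.trans hsb h.1)
  -- `y_b = m_b − H_b`, `Z_b = m_b + D_b`, Harris `D_b + H_b ≤ A Z_b`, `A = 1 − σ′`
  have hA : (prodBernoulli w).real (openConn s v)ᶜ = 1 - (prodBernoulli w).real (openConn s v) := probReal_compl_eq_one_sub (hm _)
  have hy : (prodBernoulli w).real (openConn s v ∩ openConn s b)
      = (prodBernoulli w).real (openConn s b) - (prodBernoulli w).real ((openConn s v)ᶜ ∩ (openConn b v)ᶜ ∩ openConn s b) := by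
    have e2 : ((openConn s v)ᶜ ∩ openConn s b : Set (BondConfig (Fin n))) = (openConn s v)ᶜ ∩ (openConn b v)ᶜ ∩ openConn s b := by
      ext ω
      simp only [Set.mem_inter_iff, Set.mem_compl_iff]
      constructor
      · rintro ⟨hsv, hsb⟩
        exact ⟨⟨hsv, fun hbv => hsv (SimpleGraph.Reachable.trans hsb hbv)⟩, hsb⟩
      · rintro ⟨⟨hsv, -⟩, hsb⟩
        exact ⟨hsv, hsb⟩
    have hsplit : (prodBernoulli w).real (openConn s b ∩ openConn s v) + (prodBernoulli w).real (openConn s b \ openConn s v)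
        = (prodBernoulli w).real (openConn s b) := measureReal_inter_add_sdiff (hm _)
    have e2' : (openConn s b \ openConn s v : Set (BondConfig (Fin n))) = (openConn s v)ᶜ ∩ (openConn b v)ᶜ ∩ openConn s b := by
      rw [← e2]; ext ω; simp only [Set.mem_sdiff, Set.mem_inter_iff, Set.mem_compl_iff]; tauto
    rw [Set.inter_comm, ← e2']
    linarith
  have hZ : (prodBernoulli w).real (openConn b v ∪ openConn s b)
      = (prodBernoulli w).real (openConn s b) + (prodBernoulli w).real (openConn b v \ openConn s v) := by
    rw [Set.union_comm, ← measureReal_union ?_ (hm _)]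
    · congr 1
      ext ω
      simp only [Set.mem_union, Set.mem_sdiff]
      constructor
      · rintro (h | h)
        · exact Or.inl h
        · by_cases hsv : ω ∈ openConn s v
          · exact Or.inl (SimpleGraph.Reachable.trans hsv h.symm)
          · exact Or.inr ⟨h, hsv⟩
      · rintro (h | ⟨h, -⟩)
        · exact Or.inl h
        · exact Or.inr h
    · exact Set.disjoint_left.2 fun ω hsb h => h.2 (SimpleGraph.Reachable.trans hsb h.1)
  have Har : (prodBernoulli w).real (openConn b v \ openConn s v) + (prodBernoulli w).real ((openConn s v)ᶜ ∩ (openConn b v)ᶜ ∩ openConn s b)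
      ≤ (prodBernoulli w).real (openConn s v)ᶜ * (prodBernoulli w).real (openConn b v ∪ openConn s b) := by
    have h := prodBernoulli_harris_upper_lower w ((isUpperSet_openConn b v).union (isUpperSet_openConn s b))
      (isUpperSet_openConn s v).compl (hm _) (hm _)
    rw [mul_comm]
    refine le_trans (le_of_eq ?_) h
    rw [← measureReal_union ?_ (hm _)]
    · congr 1
      ext ω
      simp only [Set.mem_union, Set.mem_sdiff, Set.mem_inter_iff, Set.mem_compl_iff]
      tauto
    · exact Set.disjoint_left.2 fun ω h1 h2 => h2.1.2 h1.1
  rw [e1, Set.inter_self, measureReal_empty, hy]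
  have hD : 0 ≤ (prodBernoulli w).real (openConn b v \ openConn s v) := measureReal_nonneg
  have hσ : (prodBernoulli w).real (openConn s v) ≤ 1 := measureReal_le_one
  have hσ0 : 0 ≤ (prodBernoulli w).real (openConn s v) := measureReal_nonneg
  have hZ1 : (prodBernoulli w).real (openConn b v ∪ openConn s b) ≤ 1 := measureReal_le_one
  -- RS = D_b·[σ′(1 − Z_b) − 2·(D_b + H_b − A·Z_b)]
  rw [hA, hZ] at Har
  rw [hZ] at hZ1
  have h1 : 0 ≤ (prodBernoulli w).real (openConn b v \ openConn s v)
      * ((1 - (prodBernoulli w).real (openConn s v)) * ((prodBernoulli w).real (openConn s b) + (prodBernoulli w).real (openConn b v \ openConn s v))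
        - ((prodBernoulli w).real (openConn b v \ openConn s v) + (prodBernoulli w).real ((openConn s v)ᶜ ∩ (openConn b v)ᶜ ∩ openConn s b))) :=
    mul_nonneg hD (by linarith)
  have h2 : 0 ≤ (prodBernoulli w).real (openConn b v \ openConn s v)
      * ((prodBernoulli w).real (openConn s v) * (1 - ((prodBernoulli w).real (openConn s b) + (prodBernoulli w).real (openConn b v \ openConn s v)))) :=
    mul_nonneg hD (mul_nonneg hσ0 (by linarith))
  nlinarith [h1, h2]

/-- **Arithmetic of the two-branch case of the R-side lemma.**  With near quantities `A₁, Db = D₁b, Hb = H₁b, mb, kb = P(x₁ hit ∧ b hit)` and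
far quantities `A′, dc, gc, mc, yc = P(v hit ∧ c hit)`:
`RS = ½σ′T₁ + ((3/2)σ′ − 1)T₂`, `T₁ = pD₁b·gc + dc·(pH₁b + (1−p)mb) ≥ 0`, `T₂ = pD₁b·cov_c + dc·Cov^B ≤ 0` (Harris), `T₁ + T₂ ≥ 0` (the two
branch lemmas). [this work] -/
theorem rs_diffBranch_real (p A' A₁ Db Hb mb kb dc gc mc yc : ℝ) (hp0 : 0 ≤ p) (hp1 : p ≤ 1) (hA'0 : 0 ≤ A') (hA'1 : A' ≤ 1)
    (hA₁0 : 0 ≤ A₁) (hA₁1 : A₁ ≤ 1) (hDb : 0 ≤ Db) (hHb : 0 ≤ Hb) (hmb : 0 ≤ mb) (hdc : 0 ≤ dc) (hgc : 0 ≤ gc)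
    (hk : kb + Hb = mb) (hy : yc + gc = mc)
    (BrNear : A₁ * (mb + Db) ≤ Db + 2 * Hb) (BrFar : A' * (mc + dc) ≤ dc + 2 * gc)
    (HarNear : Db + Hb ≤ A₁ * (mb + Db)) (HarFar : dc + gc ≤ A' * (mc + dc)) :
    0 ≤ (1 - ((1 - p) * A' + p * (A₁ * A'))) * (((1 - p) * 0 + p * (Db * gc))
        + ((1 - p) * (mb * dc) + p * (Hb * dc)) + ((1 - p) * 0 + p * (Db * dc)))
      + ((1 - p) * 0 + p * (Db * A')) * ((1 - p) * yc + p * (yc + (1 - A₁) * gc + (1 - A₁) * dc)) + ((1 - p) * dc + p * (A₁ * dc)) * ((1 - p) * (mb * (1 - A')) + p * (mb * (1 - A') + Db * (1 - A') + kb * A'))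
      - 3 / 2 * (1 - ((1 - p) * A' + p * (A₁ * A'))) * (((1 - p) * mb + p * (mb + Db * (1 - A'))) * ((1 - p) * dc + p * (A₁ * dc))
        + ((1 - p) * mc + p * (mc + (1 - A₁) * dc)) * ((1 - p) * 0 + p * (Db * A')))
      - 3 * (1 - ((1 - p) * A' + p * (A₁ * A'))) * ((1 - p) * 0 + p * (Db * A')) * ((1 - p) * dc + p * (A₁ * dc)) := by
  have hkb : kb = mb - Hb := by linarith
  have hyc : yc = mc - gc := by linarith
  have key : (1 - ((1 - p) * A' + p * (A₁ * A'))) * (((1 - p) * 0 + p * (Db * gc))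
        + ((1 - p) * (mb * dc) + p * (Hb * dc)) + ((1 - p) * 0 + p * (Db * dc)))
      + ((1 - p) * 0 + p * (Db * A')) * ((1 - p) * yc + p * (yc + (1 - A₁) * gc + (1 - A₁) * dc)) + ((1 - p) * dc + p * (A₁ * dc)) * ((1 - p) * (mb * (1 - A')) + p * (mb * (1 - A') + Db * (1 - A') + kb * A'))
      - 3 / 2 * (1 - ((1 - p) * A' + p * (A₁ * A'))) * (((1 - p) * mb + p * (mb + Db * (1 - A'))) * ((1 - p) * dc + p * (A₁ * dc))
        + ((1 - p) * mc + p * (mc + (1 - A₁) * dc)) * ((1 - p) * 0 + p * (Db * A')))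
      - 3 * (1 - ((1 - p) * A' + p * (A₁ * A'))) * ((1 - p) * 0 + p * (Db * A')) * ((1 - p) * dc + p * (A₁ * dc))
      = 1 / 2 * (1 - ((1 - p) * A' + p * (A₁ * A'))) * (p * Db * gc + dc * (p * Hb + (1 - p) * mb))
        + (3 / 2 * (1 - ((1 - p) * A' + p * (A₁ * A'))) - 1)
          * (p * Db * (dc + gc - A' * (mc + dc)) + dc * (p * (p * Db * (1 - A₁) + Hb - A₁ * mb))) := by
    rw [hkb, hyc]; ring
  rw [key]
  have hσ0 : 0 ≤ 1 - ((1 - p) * A' + p * (A₁ * A')) := by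
    have h1 : (1 - p) * A' ≤ (1 - p) := mul_le_of_le_one_right (by linarith) hA'1
    have h2 : p * (A₁ * A') ≤ p := mul_le_of_le_one_right hp0 (mul_le_one₀ hA₁1 hA'0 hA'1)
    linarith
  have hσ1 : 1 - ((1 - p) * A' + p * (A₁ * A')) ≤ 1 := by
    have h1 : 0 ≤ (1 - p) * A' + p * (A₁ * A') := add_nonneg (mul_nonneg (by linarith) hA'0) (mul_nonneg hp0 (mul_nonneg hA₁0 hA'0))
    linarith
  have hT1 : 0 ≤ p * Db * gc + dc * (p * Hb + (1 - p) * mb) :=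
    add_nonneg (mul_nonneg (mul_nonneg hp0 hDb) hgc) (mul_nonneg hdc (add_nonneg (mul_nonneg hp0 hHb) (mul_nonneg (by linarith) hmb)))
  have hCovB : p * (p * Db * (1 - A₁) + Hb - A₁ * mb) ≤ 0 := by
    have h1 : p * Db * (1 - A₁) + Hb - A₁ * mb = (Db + Hb - A₁ * (mb + Db)) - (1 - p) * Db * (1 - A₁) := by ring
    have h2 : 0 ≤ (1 - p) * Db * (1 - A₁) := mul_nonneg (mul_nonneg (by linarith) hDb) (by linarith)
    exact mul_nonpos_of_nonneg_of_nonpos hp0 (by linarith)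
  have hT2 : p * Db * (dc + gc - A' * (mc + dc)) + dc * (p * (p * Db * (1 - A₁) + Hb - A₁ * mb)) ≤ 0 := by
    have h1 : p * Db * (dc + gc - A' * (mc + dc)) ≤ 0 := mul_nonpos_of_nonneg_of_nonpos (mul_nonneg hp0 hDb) (by linarith)
    have h2 : dc * (p * (p * Db * (1 - A₁) + Hb - A₁ * mb)) ≤ 0 := mul_nonpos_of_nonneg_of_nonpos hdc hCovB
    linarith
  have hsum : 0 ≤ (p * Db * gc + dc * (p * Hb + (1 - p) * mb))
      + (p * Db * (dc + gc - A' * (mc + dc)) + dc * (p * (p * Db * (1 - A₁) + Hb - A₁ * mb))) := by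
    have e : (p * Db * gc + dc * (p * Hb + (1 - p) * mb))
        + (p * Db * (dc + gc - A' * (mc + dc)) + dc * (p * (p * Db * (1 - A₁) + Hb - A₁ * mb)))
        = p * Db * (dc + 2 * gc - A' * (mc + dc))
          + dc * ((1 - p) * (2 * p * Hb + mb * (1 - p * A₁)) + p ^ 2 * (Db + 2 * Hb - A₁ * (mb + Db))) := by ring
    rw [e]
    have h1 : 0 ≤ p * Db * (dc + 2 * gc - A' * (mc + dc)) := mul_nonneg (mul_nonneg hp0 hDb) (by linarith)
    have h2 : 0 ≤ 1 - p * A₁ := by nlinarith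
    have h3 : 0 ≤ (1 - p) * (2 * p * Hb + mb * (1 - p * A₁)) :=
      mul_nonneg (by linarith) (add_nonneg (mul_nonneg (mul_nonneg (by norm_num) hp0) hHb) (mul_nonneg hmb h2))
    have h4 : 0 ≤ p ^ 2 * (Db + 2 * Hb - A₁ * (mb + Db)) := mul_nonneg (sq_nonneg p) (by linarith)
    exact add_nonneg h1 (mul_nonneg hdc (add_nonneg h3 h4))
  by_cases hcase : 3 / 2 * (1 - ((1 - p) * A' + p * (A₁ * A'))) - 1 ≤ 0
  · have h1 := mul_nonneg_of_nonpos_of_nonpos hcase hT2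
    have h2 := mul_nonneg hσ0 hT1
    linarith
  · push Not at hcase
    have h3 := mul_nonneg hcase.le hsum
    have h4 := mul_nonneg (sub_nonneg.2 hσ1) hT1
    linarith

end IncStar

end Summit.CriticalPhenomena.PercolationContinuityZ3.Theorems
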